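import Summits.BirchSwinnertonDyer.BirchSwinnertonDyer.Theorems.AdditiveKolyvaginRoadVisibleCoreBricks
import Summits.BirchSwinnertonDyer.BirchSwinnertonDyer.Theorems.AdditiveKolyvaginRoadEigen
import Summits.BirchSwinnertonDyer.BirchSwinnertonDyer.Theorems.AdditiveKolyvaginRoadAdmissibleRaiseFree
import Summits.BirchSwinnertonDyer.BirchSwinnertonDyer.Theorems.AdditiveKolyvaginRoadLevelSystemsBottomOfRaise
import Summits.BirchSwinnertonDyer.BirchSwinnertonDyer.Theorems.SchneiderFreeAdditiveX3PoitouTateSelmerDualityHolds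
import Literature.NumberTheory.EllipticCurves.HeegnerPointsKolyvaginSelmerProofs
import Summits.BirchSwinnertonDyer.BirchSwinnertonDyer.Theorems.ClassRecordThreeShimuraKolyvaginImageInputs
import Literature.NumberTheory.Automorphic.BrandtGrossPoints
import Literature.NumberTheory.Automorphic.BrandtEigenLine
import Literature.NumberTheory.EllipticCurves.ZhangLevelRaisedKolyvaginData
import Summits.BirchSwinnertonDyer.BirchSwinnertonDyer.Theses.SignedBaseChange
import Summits.BirchSwinnertonDyer.BirchSwinnertonDyer.Theorems.SignedBaseChangeAnticyclotomicEisensteinDivisibilityAdmdefSelmerWalk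
import Summits.BirchSwinnertonDyer.BirchSwinnertonDyer.Theorems.SignedBaseChangeAnticyclotomicEisensteinDivisibilityAdmdefRamifiedNS
import HarnessLib

/-!
# Crux `AnticyclotomicEisensteinDivisibility` (item stmt-BirchSwinnertonDyer-20727, route `SignedBaseChange`) —
# crux-idea «signdetour» (ideator seat bsd-idea-5 g23, lens «transfer» at crux level; publish-only sketch REV 3, W-79: registered on nothing; rev 2 = rev 1 + §5, the plug into the LEAD's skeleton v7 in its own currency with (Cheb) and (Sup±) discharged)
# REV 3 (g30) = REV 2 with ONE token changed in all eight texts (`DefiniteAnchorAtSigned`, the two [NV″] copies, `DefiniteAnchorNS`,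
# `DefiniteAnchorSignedNS`, three plugs): the Gross period is the WEIGHTED class sum `Brandt.toricPeriod S.O ψ I (fun i ↦ (Brandt.weight S.O i : ZMod p) * φ i)`
# (= Σ_𝔞 w(x_𝔞) φ(x_𝔞); `mulVec` = divisor convention for `Brandt.eigenSpace … (Brandt.matrix S.O) …` kept), per the LEAD's finding F6
# (`Lines/admdef-lead-g20.md`: witness (N⁺,N⁻) = (1,11), K = ℚ(√−15), unweighted orbit sum 0, weighted 1) and its skeleton v14/v15 (a971fa4d377eafea),
# which inlines the signed detour with these weighted texts (`Lines/admdef.lean` ll. 949–1200).  No proof changed (the period is an atom in every proof here).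

## THE SIGNED DETOUR: at a zero vertex of the definite level-raising graph one may insert TWO admissible primes of ANY PRESCRIBED
## Bertolini–Darmon sign and land on a zero vertex again — so the odd definite vertex feeding v6.1's research stubs
## `DefiniteToricNVTwoMult` ∕ `DefiniteToricNVLeOneMult` ([NV″], `Lines/admdef.lean` ll.474–531) can be taken to CARRY BOTH SIGNS, which is
## exactly the per-form Steinberg-sign hypothesis of the only general-level non-ordinary rank-0 input in print (X. Wan 2016 Thm. 1.4) for the
## level-raised newform `g_n` AND for its twist `g_n ⊗ χ_K` (opposite signs at the inert primes of `n`), with NO hypothesis on E's multiplicative primes.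

TRANSFER (what is ported, and the first non-transferring step).  The sibling is CHKLL25 §7.4 ∕ Thm. 7.6 (square-free `N`): the walk of
[Zha14, Thm. 9.1] to a definite vertex `m` with `Sel(A_{g_m}/K)[℘] = 0`, then the rank-0 `℘`-BSD formula for `g_m/ℚ` and `g_m^K/ℚ` from the
non-ordinary Iwasawa main conjecture [CÇSS18, Thm. C] — an input with NO local-sign hypothesis.  On cell β (`p ≥ 5` supersingular, `¬ Squarefree N_E`)
[CÇSS18] ∕ [CLW22, Thm. 8.2.1] ∕ [CHKLL25, Thm. 7.6] are unavailable (semistable level only, and additive local types are frozen along every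
congruence), and the one general-level substitute, [Wan16, Thm. 1.4], asks of EACH form an exactly-dividing prime `ℓ` with `π_ℓ = St ⊗ χ_ur`,
`χ_ur(ℓ) = −1` (weight 2: `a_ℓ = −1`).  For `g_n` this is «some `q ∈ n` of BD-sign `ε_q = −1`, or some `ℓ ∥ N_E` with `a_ℓ(E) = −1`»; for
`g_n ⊗ χ_K` (inert `q`: `a_q(g_n ⊗ χ_K) = −ε_q`; split `ℓ ∣ N_E`: `a_ℓ` unchanged) it is «some `q ∈ n` of sign `+1`, or the same `ℓ`».  So unless
E has a multiplicative prime with `a_ℓ(E) = −1` (sub-cell β_−; e.g. NOT on β″ = squarefull `N_E`), the definite vertex must contain BOTH signs —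
and W. Zhang's walk, whose inserted primes have their signs DICTATED by the Selmer eigen-dimensions (the sign of a detecting prime is forced,
AKR `loc_eq_zero_of_sign_ne_odd`), does not provide that.  THIS is the first non-transferring step; the lever below repairs it inside the walk.

LEVER (kernel here, §3): at a vertex `n` with `Sel_n^+ = Sel_n^− = 0`, for ANY new admissible `q` of (Equiv)-sign `s`
(complex conjugation acts on `H¹(K_q, E[p])` by `sgnP s` = the BD sign, W. Zhang (9.2), AKR `localEquiv_of_admQ`):
(i) `Sel_{n∪q}^{s}` has dimension exactly 1 (Gross–Parson parity, RAISING half — AKR `selQP_raise_of_admQ_of_sign`, kernel modulo the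
Poitou–Tate fact, itself kernel: `poitouTate_selmerStructure_duality_holds`) and `Sel_{n∪q}^{¬s} = Sel_n^{¬s} = 0` (forced sign, AKR
`selQP_insert_eq_of_forall_mem_torsionLocalKer`); (ii) a Čebotarev prime `q′ ∉ n ∪ q` detecting the new class kills it (AKR lowering
`selQP_rankLowering_of_localGlobal` with the four kernel local inputs) and its sign is FORCED to be `s`; so `n ∪ {q, q′}` is a zero vertex with two
more primes, both of sign `s`.  Two detours from W. Zhang's odd zero vertex give an ODD zero vertex carrying both signs (`#n* = #n + 4`).

CONSEQUENCE FOR THE TYPING of (P3): selwalk's `DefiniteAnchorAt` (∀ odd zero vertices) is MORE than [Wan16] ×2 delivers on β ∖ β_−; the weaker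
`DefiniteAnchorAtSigned` (§2: odd zero vertices carrying both signs) is what it delivers, and §4 shows it still yields [NV″]'s consequent VERBATIM.

THIS FILE (sorry-free; conditional only on the named Props of §2, which are NOT asserted):
* §1 `EquivSign` (the (Equiv)-sign of an admissible prime, AKR binder shape; `equivSign_exists` = AKR kernel), `HasBothSigns`.
* §2 the inputs as Props: `SignedSupplyAt` (Čebotarev: admissible primes of each sign outside any finite set — PRINT, BD05 Thm. 3.2 ∕ Zha14 Lemma 7.3;
  tree-adjacent AKR `Cheb.exists_admissible_target … hν`), `LocalChebAt` and `OddBottomDim` (selwalk's (Cheb), (Par), restated verbatim — no workfile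
  import), `DefiniteAnchorAtSigned N` (the re-typed (P3)).
* §3 KERNEL: `selQP_insert_eq_of_equivSign_ne` (wrong-sign eigenspace frozen), `finrank_selQP_insert_eq_one` (raising at a zero vertex),
  `equivSign_of_detects` (a prime that moves `Sel^s` has sign `s`), `exists_signed_detour`, `exists_zero_vertex_above_of_localChebAt` (selwalk §4
  verbatim), `exists_oddZeroVertex_bothSigns`.
* §4 `definiteToricNV_of_signdetour : SignedSupplyAt → LocalChebAt → OddBottomDim → DefiniteAnchorAtSigned N → [NV″ consequent verbatim]`, its `c`-FREE
  plug form `definiteToricNV_of_signdetour_of_oddSelmerDim` (literal «`dim Sel_p(E/K)` odd», every `c ≠ 1`), and `definiteAnchorAtSigned_of_forall` (selwalk's ∀-anchor ⇒ (Anch±)).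

NOT HERE: no `instance`, no notation, no named fact, no import of crux workfiles (W-79); the `ZMod p`-structure of `H¹(K, E[p])` is an instance
BINDER as in every AKR file.  Nothing is booked; BSD is not proved by any of this.

References: [cite: arXiv:1607.07729 (X. Wan 2016), Thm. 1.4 (p. 4 ll. 17–32)] [cite: CastellaEtAl2025, Thm. 7.6 + fn. 8, §7.4 (arXiv:2308.10474 pp. 31–33)]
[cite: WZhang2014, Lemma 5.3, Prop. 5.4, Lemma 7.3, Thm. 9.1 (proof), §9 (9.2)] [cite: BertoliniDarmon2005, Lemma 2.6, Thm. 3.2, §2.2–§2.3]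
[cite: GrossParson, Lemma 9] [cite: arXiv:2012.11771 (N. Sweeting 2020), Lemma 8.3, Thm. 9.4, Rem. 9.5, Thm. 10.2] [cite: arXiv:2107.13726
(Fouquet–Wan 2021), Thm. 1.7, Cor. 1.10] [cite: SkinnerZhang2014, Cor. 9.2, Lemmas 9.5–9.6] [cite: MilneADT2006, Ch. I, Thm. 4.10].
-/

-- D-0017: single-problem summit, the namespace repeats the problem name by design.
set_option linter.dupNamespace false
set_option autoImplicit false

noncomputable section

open scoped Classical NumberField Pointwise

namespace Summit.BirchSwinnertonDyer.BirchSwinnertonDyer.Cruxes.AnticyclotomicEisensteinDivisibility.Signdetour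

open Function WeierstrassCurve NumberField IsDedekindDomain Field Module
  Literature.NumberTheory.EllipticCurves Literature.NumberTheory.EllipticCurves.ModularForms
  Literature.NumberTheory.EllipticCurves.Rank1Residual
  Literature.NumberTheory.GaloisRepresentations Literature.NumberTheory.GaloisRepresentations.DiscreteGaloisModule
  Literature.NumberTheory.GaloisCohomology Literature.NumberTheory.Automorphic
  Summit.BirchSwinnertonDyer.Rank1Residual.X11b Summit.BirchSwinnertonDyer.Rank1Residual.GaloisImage
  Summit.BirchSwinnertonDyer.BirchSwinnertonDyer.Theorems Summit.BirchSwinnertonDyer.BirchSwinnertonDyer.Theorems.AdditiveKoly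
  Summit.BirchSwinnertonDyer.BirchSwinnertonDyer.Theorems.SchneiderFreeAdditiveX3.PoitouTateReduction

variable (W : WeierstrassCurve ℚ) (K : Type) [Field K] [NumberField K] (p : ℕ) [W.IsElliptic] [W.IsGloballyMinimal] [Fact p.Prime]

/-! ## §1 The (Equiv)-sign of an admissible prime (= its Bertolini–Darmon sign), in the AKR binder shape -/

section Sign

variable (c : K ≃ₐ[ℚ] K) [Module (ZMod p) (Vp W K p)]

/-- **The (Equiv)-sign of a Bertolini–Darmon admissible prime `q`**: complex conjugation `c` acts on `H¹(K_v, E[p])` by the scalar `sgnP s` at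
every place `v ∣ q` (there is exactly one, `q` being inert).  By W. Zhang (9.2) (AKR `localEquiv_of_admQ`: the lift `Frob_q` of `c` acts on `E[p]` with
eigenvalues `ε_q, ε_q q`) this `s` is the BD sign: `a_q(E) ≡ sgnP s · (q + 1) (mod p)`, i.e. the `U_q`-eigenvalue of every level-raised newform
`g_n`, `q ∈ n`, is `sgnP s`, and that of `g_n ⊗ χ_K` is `−sgnP s`.  [cite: WZhang2014, §9 (9.2)] [cite: BertoliniDarmon2005, §2.2, Lemma 2.6] -/
def EquivSign (q : AdmQ W K p) (s : Bool) : Prop :=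
  ∀ v : HeightOneSpectrum (𝓞 K), ((q : ℕ) : 𝓞 K) ∈ v.asIdeal → ∀ z : Vp W K p,
    (W.baseChange K).torsionLocMap (v.adicCompletion K) ((p ^ 1 : ℕ) : ℤ) (conjAct W c ((p ^ 1 : ℕ) : ℤ) z) =
      sgnP s • (W.baseChange K).torsionLocMap (v.adicCompletion K) ((p ^ 1 : ℕ) : ℤ) z

omit [Module (ZMod p) (Vp W K p)] in
/-- **Every admissible prime HAS an (Equiv)-sign** — AKR kernel (`localEquiv_of_admQ`, `[K:ℚ] = 2`, `c ≠ 1`).  [cite: WZhang2014, §9 (9.2)] -/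
theorem equivSign_exists (hK2 : Module.finrank ℚ K = 2) (hc1 : c ≠ 1) (q : AdmQ W K p) : ∃ s : Bool, EquivSign W K p c q s :=
  localEquiv_of_admQ W K p hK2 hc1 q

/-- **A level carries BOTH signs**: it contains an admissible prime of (Equiv)-sign `+1` and one of sign `−1` — so that BOTH `g_n` (needs a `q ∈ n` with
`a_q(g_n) = −1`) and `g_n ⊗ χ_K` (needs a `q ∈ n` with `a_q(g_n) = +1`) have a Steinberg prime of the type required by [Wan16, Thm. 1.4].
[cite: arXiv:1607.07729 (X. Wan 2016), Thm. 1.4] -/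
def HasBothSigns (n : Finset (AdmQ W K p)) : Prop :=
  ∀ s : Bool, ∃ q ∈ n, EquivSign W K p c q s

end Sign

/-! ## §2 The inputs, as Props (NOT asserted) -/

section Inputs

variable (c : K ≃ₐ[ℚ] K) [Module (ZMod p) (Vp W K p)]

/-- **(Sup±) SIGNED SUPPLY of admissible primes**: for each sign `s` and each finite set `B₀` of admissible primes there is an admissible `q ∉ B₀` of
(Equiv)-sign `s`.  PRINT: Čebotarev in `K(E[p])/ℚ` applied to the class of `c·σ` with `ρ̄(σ)` of eigenvalues `{±1, ±u}`, `u ≢ ±1` — both signs have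
positive density once `ρ̄_{E,p}` is onto (BD05 Thm. 3.2 ∕ Zha14 Lemma 7.3, the `x = 0` case); tree-adjacent: AKR `Cheb.exists_admissible_target … (hν : ν = 1 ∨ ν = -1)`.
[cite: BertoliniDarmon2005, Thm. 3.2] [cite: WZhang2014, Lemma 7.3] -/
def SignedSupplyAt : Prop :=
  ∀ (s : Bool) (B₀ : Finset (AdmQ W K p)), ∃ q : AdmQ W K p, q ∉ B₀ ∧ EquivSign W K p c q s

/-- **(Cheb)** — selwalk's `LocalChebAt` VERBATIM (the binder shape of AKR `selQP_rankLowering_of_localGlobal`): every non-zero class of `Sel_n^μ` is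
detected by its localisation at the place of some NEW admissible prime.  KERNEL at `p ∣ N_E` (AKR `localCheb_of_admQ_of_dvd`); hands on cell β.
[cite: WZhang2014, Lemma 7.3] [cite: BertoliniDarmon2005, Thm. 3.2] -/
def LocalChebAt : Prop :=
  ∀ (n : Finset (AdmQ W K p)) (μ : Bool) (x : Vp W K p), x ∈ SelQP W K p c n μ → x ≠ 0 →
    ∃ q : AdmQ W K p, q ∉ n ∧ ∃ v : HeightOneSpectrum (𝓞 K),
      ((q : ℕ) : 𝓞 K) ∈ v.asIdeal ∧ (W.baseChange K).torsionLocMap (v.adicCompletion K) ((p ^ 1 : ℕ) : ℤ) x ≠ 0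

/-- **(Par)** — selwalk's `OddBottomDim` VERBATIM: `dim Sel_∅⁺ + dim Sel_∅⁻` is odd (PRINT on the crux frame: `p`-parity over `ℚ` twice + Cassels–Tate).
[cite: DokchitserDokchitser2010, Thm. 1.4] [cite: WZhang2014, Thm. 9.2] -/
def OddBottomDim : Prop :=
  Odd (finrank (ZMod p) (SelQP W K p c ∅ true) + finrank (ZMod p) (SelQP W K p c ∅ false))

/-- **(Par), `c`-free literal form** — selwalk's `OddSelmerDim` VERBATIM: the `ZMod p`-rank of the whole `p`-Selmer group `Sel_p(E/K) ⊂ H¹(K, E[p])` is odd.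
[cite: DokchitserDokchitser2010, Thm. 1.4] [cite: WZhang2014, Thm. 9.2] -/
def OddSelmerDim : Prop :=
  Odd (finrank (ZMod p) (AddSubgroup.toZModSubmodule p (selmerGroup (W.baseChange K) ((p ^ 1 : ℕ) : ℤ))))

/-- **`c`-free (Par) ⟹ eigen (Par)** by the AKR KERNEL identity `finrank_selmer_eq_finrank_selQP_add` (selwalk §2 verbatim).  [cite: WZhang2014, §5 (5.1)] -/
theorem oddBottomDim_of_oddSelmerDim (hp2 : p ≠ 2) (hK : IsImaginaryQuadratic K) (hodd : OddSelmerDim W K p) :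
    OddBottomDim W K p c := by
  unfold OddBottomDim
  rw [← finrank_selmer_eq_finrank_selQP_add W K p hp2 hK c
    (Summit.BirchSwinnertonDyer.Rank1Residual.X11b.Three.Koly.Method2.algEquiv_mul_self_eq_one K hK c)]
  exact hodd

/-- **(Anch±) = (P3) RE-TYPED — the DEFINITE ANCHOR at an odd zero vertex CARRYING BOTH SIGNS**, in the currency of v6.1's [NV″]: at every odd admissible
level `n` containing a prime of each (Equiv)-sign and with `Sel_n^+ = Sel_n^− = 0` there are a definite setup of discriminant `∏ n` and Eichler level `N`,
an optimal embedding, a Gross point and a mod-`p` Brandt eigenvector for `a_•(E)` with non-zero toric period.  Intended discharge (hands, NOT asserted):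
Gross–Parson `Sel_n = Sel_℘(A_{g_n}/K)[℘]` (Zha14 Thm. 5.2) ⇒ `Sel_{℘^∞}(A_{g_n}/K) = 0` ⇒ by [Wan16, Thm. 1.4] for `g_n` (Steinberg prime: the `q ∈ n` of
sign `−1`) and for `g_n ⊗ χ_K` (the `q ∈ n` of sign `+1`) + the Kato ∕ Greenberg–Vatsal lower bound + [SZ14, Cor. 9.2, Lemmas 9.5–9.6] period relation:
`L^alg(g_n/K,1)` is a `℘`-unit up to Tamagawa exponents, which vanish at admissible `q` (component group Eisenstein) and are controlled at `ℓ ∣ N_E`;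
Gross's formula mod `℘` + Jacquet–Langlands mod `p` turn this into `toricPeriod ≠ 0`.  Strictly WEAKER than selwalk's `DefiniteAnchorAt`.
[cite: arXiv:1607.07729 (X. Wan 2016), Thm. 1.4] [cite: WZhang2014, Thm. 5.2, Thm. 7.2] [cite: SkinnerZhang2014, Cor. 9.2] [cite: Gross1987, Prop. 10.3, §11] -/
def DefiniteAnchorAtSigned (N : ℕ) : Prop :=
  ∀ n : Finset (AdmQ W K p), Odd n.card → HasBothSigns W K p c n → (∀ μ : Bool, SelQP W K p c n μ = ⊥) →
    ∃ (S : Brandt.XiSetup N (∏ q ∈ n.image Subtype.val, q)) (ψ : K →ₐ[ℚ] S.D) (I : Submodule ℤ S.D)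
      (φ : Brandt.ClassSet S.O → ZMod p),
      Brandt.IsGrossPoint S.O ψ I ∧
      (letI : Fintype (Brandt.ClassSet S.O) := Fintype.ofFinite _
       φ ∈ Brandt.eigenSpace (ZMod p) (N * ∏ q ∈ n.image Subtype.val, q) (Brandt.matrix S.O) (fun ℓ ↦ W.frobeniusTrace ℓ)) ∧
      Brandt.toricPeriod S.O ψ I (fun i ↦ (Brandt.weight S.O i : ZMod p) * φ i) ≠ 0

end Inputs

/-! ## §3 KERNEL: the signed detour -/

section Detour

variable {W K p} {c : K ≃ₐ[ℚ] K} [Module (ZMod p) (Vp W K p)]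

omit [W.IsElliptic] in
/-- **The WRONG-SIGN eigenspace does not move** (forced sign, W. Zhang (9.2)–(9.3)): if `q ∉ n` has (Equiv)-sign `s` then `Sel_{n∪q}^{¬s} = Sel_n^{¬s}`
(every `¬s`-eigenclass has localisation ZERO above `q` — `loc = −loc` on odd torsion —, and a class with localisation zero is both Kummer and toric).
AKR `loc_eq_zero_of_sign_ne_odd` + `selQP_insert_eq_of_forall_mem_torsionLocalKer`.  [cite: WZhang2014, §9 (9.2)–(9.3)] -/
theorem selQP_insert_eq_of_equivSign_ne (hp2 : p ≠ 2) {n : Finset (AdmQ W K p)} {q : AdmQ W K p} (hqn : q ∉ n) {s μ : Bool}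
    (hs : EquivSign W K p c q s) (hne : s ≠ μ) : SelQP W K p c (insert q n) μ = SelQP W K p c n μ := by
  have hp : p.Prime := Fact.out
  have hNodd : Odd (((p ^ 1 : ℕ) : ℤ)) := by
    rw [pow_one]; exact_mod_cast hp.odd_of_ne_two hp2
  refine selQP_insert_eq_of_forall_mem_torsionLocalKer W K p c n q hqn μ fun y hy v hv ↦ ?_
  exact AddMonoidHom.mem_ker.mpr
    (loc_eq_zero_of_sign_ne_odd (conjAct W c ((p ^ 1 : ℕ) : ℤ)) ((W.baseChange K).torsionLocMap (v.adicCompletion K) ((p ^ 1 : ℕ) : ℤ))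
      (hs v hv) hy hne hNodd (zsmul_discreteH1_torsion ((p ^ 1 : ℕ) : ℤ) _))

/-- **A prime that MOVES `Sel^s` has (Equiv)-sign `s`**: if `Sel_{n∪q}^s ≠ Sel_n^s` then `q` has sign `s` (it has some sign, and the wrong one freezes
`Sel^s`).  [cite: WZhang2014, §9 (9.2)] -/
theorem equivSign_of_ne (hK2 : Module.finrank ℚ K = 2) (hc1 : c ≠ 1) (hp2 : p ≠ 2) {n : Finset (AdmQ W K p)} {q : AdmQ W K p}
    (hqn : q ∉ n) {s : Bool} (hmove : SelQP W K p c (insert q n) s ≠ SelQP W K p c n s) : EquivSign W K p c q s := by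
  obtain ⟨s', hs'⟩ := equivSign_exists W K p c hK2 hc1 q
  by_cases h : s' = s
  · exact h ▸ hs'
  · exact absurd (selQP_insert_eq_of_equivSign_ne hp2 hqn hs' h) hmove

/-- **RAISING AT A ZERO VERTEX** (Gross–Parson parity, raising half; W. Zhang Lemma 5.3 ∕ Prop. 5.4): if `Sel_n^s = 0` and `q ∉ n` has (Equiv)-sign `s`
then `dim Sel_{n∪q}^s = 1`.  AKR `selQP_raise_of_admQ_of_sign` (witness-free raising) with the Poitou–Tate fact discharged by the tree's
`poitouTate_selmerStructure_duality_holds`.  [cite: WZhang2014, Lemma 5.3, Prop. 5.4] [cite: GrossParson, Lemma 9] [cite: MilneADT2006, Ch. I, Thm. 4.10] -/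
theorem finrank_selQP_insert_eq_one (hK : IsImaginaryQuadratic K) (hp2 : p ≠ 2) {n : Finset (AdmQ W K p)} {q : AdmQ W K p}
    (hqn : q ∉ n) {s : Bool} (hs : EquivSign W K p c q s) (hzero : SelQP W K p c n s = ⊥) :
    finrank (ZMod p) (SelQP W K p c (insert q n) s) = 1 := by
  obtain ⟨v, hv⟩ := exists_heightOneSpectrum_natCast_mem' K q.2.1
  have h := selQP_raise_of_admQ_of_sign W K p hK hp2 (poitouTate_selmerStructure_duality_holds K) n q s v hqn hv (hs v hv)
    (fun y hy ↦ by rw [hzero, Submodule.mem_bot] at hy; rw [hy]; exact zero_mem _)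
  rw [h, hzero, finrank_bot]

omit [W.IsElliptic] in
/-- A space of positive dimension has a non-zero vector (bookkeeping). [folklore] -/
theorem exists_ne_zero_of_finrank_pos {n : Finset (AdmQ W K p)} {μ : Bool} (h : 0 < finrank (ZMod p) (SelQP W K p c n μ)) :
    ∃ x ∈ SelQP W K p c n μ, x ≠ 0 := by
  by_contra hall
  push Not at hall
  have : SelQP W K p c n μ = ⊥ := (Submodule.eq_bot_iff _).mpr hall
  rw [this, finrank_bot] at h
  exact lt_irrefl 0 h

/-- **(A1) RANK LOWERING from (Cheb) alone** — selwalk §4 verbatim: AKR `selQP_rankLowering_of_localGlobal` fed with (Cheb) and the four KERNEL local inputs.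
[cite: WZhang2014, Prop. 5.4, §9 (9.1)–(9.2)] [cite: BertoliniDarmon2005, Lemma 2.6] -/
theorem selQP_rankLowering_of_localChebAt (hK : IsImaginaryQuadratic K) (hp2 : p ≠ 2) (hc1 : c ≠ 1) (hcheb : LocalChebAt W K p c) :
    ∀ (n : Finset (AdmQ W K p)) (μ : Bool) (x : Vp W K p),
      x ∈ SelQP W K p c n μ → x ≠ 0 →
      ∃ q : AdmQ W K p, q ∉ n ∧ x ∉ SelQP W K p c (insert q n) μ ∧
        SelQP W K p c (insert q n) μ ≤ SelQP W K p c n μ ∧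
        finrank (ZMod p) (SelQP W K p c (insert q n) μ) + 1 = finrank (ZMod p) (SelQP W K p c n μ) ∧
        SelQP W K p c (insert q n) (!μ) = SelQP W K p c n (!μ) :=
  selQP_rankLowering_of_localGlobal W K p c ((Fact.out : p.Prime).odd_of_ne_two hp2) hcheb
    (localEquiv_of_admQ W K p hK.1 hc1) (localLine_of_admQ W K p hK.1) (localTrans_of_admQ W K p) (hiso_of_admQ W K p c hK)

/-- **THE SIGNED DETOUR.**  At a zero vertex `n` (`Sel_n^+ = Sel_n^− = 0`) and for ANY sign `s` there are admissible `q ∉ n` and `q′ ∉ n ∪ {q}`, BOTH of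
(Equiv)-sign `s`, with `n ∪ {q, q′}` again a zero vertex: take `q` of sign `s` outside `n` ((Sup±)); `Sel_{n∪q}^s` is a line (raising) and `Sel_{n∪q}^{¬s} = 0`
(frozen); a (Cheb) prime `q′` detecting a generator lowers `Sel^s` back to `0`, leaves `Sel^{¬s} = 0`, and has sign `s` because it moves `Sel^s`.
[cite: WZhang2014, Lemma 5.3, Prop. 5.4, Lemma 7.3, §9 (9.2)] [cite: GrossParson, Lemma 9] [cite: arXiv:2012.11771 (N. Sweeting 2020), Lemma 8.3, Rem. 9.5] -/
theorem exists_signed_detour (hK : IsImaginaryQuadratic K) (hp2 : p ≠ 2) (hc1 : c ≠ 1)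
    (hsup : SignedSupplyAt W K p c) (hcheb : LocalChebAt W K p c)
    (n : Finset (AdmQ W K p)) (hzero : ∀ μ : Bool, SelQP W K p c n μ = ⊥) (s : Bool) :
    ∃ q q' : AdmQ W K p, q ∉ n ∧ q' ∉ insert q n ∧ EquivSign W K p c q s ∧ EquivSign W K p c q' s ∧
      ∀ μ : Bool, SelQP W K p c (insert q' (insert q n)) μ = ⊥ := by
  obtain ⟨q, hqn, hqs⟩ := hsup s n
  -- after `q`: the `s`-part is a line, the `¬s`-part is still zero
  have h1 : finrank (ZMod p) (SelQP W K p c (insert q n) s) = 1 := finrank_selQP_insert_eq_one hK hp2 hqn hqs (hzero s)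
  have h1' : SelQP W K p c (insert q n) (!s) = ⊥ := by
    rw [selQP_insert_eq_of_equivSign_ne hp2 hqn hqs (by cases s <;> decide), hzero]
  obtain ⟨d, hd, hd0⟩ := exists_ne_zero_of_finrank_pos (by rw [h1]; exact one_pos)
  -- kill the new class at a Čebotarev prime `q'`
  obtain ⟨q', hq'n, hdq', -, hfr, heq⟩ := selQP_rankLowering_of_localChebAt hK hp2 hc1 hcheb (insert q n) s d hd hd0
  refine ⟨q, q', hqn, hq'n, hqs, ?_, fun μ ↦ ?_⟩
  · refine equivSign_of_ne hK.1 hc1 hp2 hq'n fun h ↦ hdq' ?_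
    rw [h]; exact hd
  · by_cases hμ : μ = s
    · subst hμ
      haveI := finiteDimensional_selQP W K p c (insert q' (insert q n)) μ
      have h0 : finrank (ZMod p) (SelQP W K p c (insert q' (insert q n)) μ) = 0 := by omega
      exact Submodule.finrank_eq_zero.mp h0
    · have hμ' : μ = !s := by cases μ <;> cases s <;> simp_all
      rw [hμ', heq, h1']

/-- **DESCENT TO A ZERO VERTEX from (Cheb)** — selwalk §4 verbatim (the proof of AKR `exists_zero_vertex_above`): above every level `n` there is `n' ⊇ n`
with `Sel_{n'}^± = 0` and `#n' = #n + dim Sel_n⁺ + dim Sel_n⁻`.  [cite: WZhang2014, Thm. 9.1 (proof)] [cite: CastellaEtAl2025, §7.4] -/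
theorem exists_zero_vertex_above_of_localChebAt (hK : IsImaginaryQuadratic K) (hp2 : p ≠ 2) (hc1 : c ≠ 1)
    (hcheb : LocalChebAt W K p c) (n : Finset (AdmQ W K p)) :
    ∃ n' : Finset (AdmQ W K p), n ⊆ n' ∧ (∀ μ : Bool, SelQP W K p c n' μ = ⊥) ∧
      n'.card = n.card + (finrank (ZMod p) (SelQP W K p c n true) + finrank (ZMod p) (SelQP W K p c n false)) := by
  suffices h : ∀ (r : ℕ) (n : Finset (AdmQ W K p)),
      finrank (ZMod p) (SelQP W K p c n true) + finrank (ZMod p) (SelQP W K p c n false) = r →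
      ∃ n' : Finset (AdmQ W K p), n ⊆ n' ∧ (∀ μ : Bool, SelQP W K p c n' μ = ⊥) ∧ n'.card = n.card + r from
    h _ n rfl
  intro r
  induction r with
  | zero =>
    intro n hn
    refine ⟨n, subset_rfl, fun μ ↦ ?_, by rw [add_zero]⟩
    haveI := finiteDimensional_selQP W K p c n μ
    have h0 : finrank (ZMod p) (SelQP W K p c n μ) = 0 := by cases μ <;> omega
    exact Submodule.finrank_eq_zero.mp h0
  | succ r ih =>
    intro n hn
    obtain ⟨μ, hμ⟩ : ∃ μ : Bool, 0 < finrank (ZMod p) (SelQP W K p c n μ) := by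
      by_cases h : 0 < finrank (ZMod p) (SelQP W K p c n true)
      · exact ⟨true, h⟩
      · exact ⟨false, by omega⟩
    obtain ⟨x, hx, hx0⟩ := exists_ne_zero_of_finrank_pos hμ
    obtain ⟨q, hqn, -, -, hfr, heq⟩ := selQP_rankLowering_of_localChebAt hK hp2 hc1 hcheb n μ x hx hx0
    have htot : finrank (ZMod p) (SelQP W K p c (insert q n) true) +
        finrank (ZMod p) (SelQP W K p c (insert q n) false) = r := by
      cases μ
      · have heq' : SelQP W K p c (insert q n) true = SelQP W K p c n true := heq
        rw [heq']
        omega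
      · have heq' : SelQP W K p c (insert q n) false = SelQP W K p c n false := heq
        rw [heq']
        omega
    obtain ⟨n', hsub, hzero, hcard⟩ := ih (insert q n) htot
    refine ⟨n', (Finset.subset_insert q n).trans hsub, hzero, ?_⟩
    rw [hcard, Finset.card_insert_of_notMem hqn]
    omega

/-- **AN ODD ZERO VERTEX CARRYING BOTH SIGNS.**  From (Sup±), (Cheb) and an odd bottom dimension: W. Zhang's walk to an odd zero vertex `n₀`
(`#n₀ = dim Sel⁺ + dim Sel⁻`), then one signed detour of each sign — an admissible level of odd cardinality `#n₀ + 4` with `Sel^± = 0` containing a prime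
of (Equiv)-sign `+1` and one of sign `−1`.  [cite: WZhang2014, Thm. 9.1 (proof)] [cite: CastellaEtAl2025, §7.4] [cite: arXiv:1607.07729 (X. Wan 2016), Thm. 1.4] -/
theorem exists_oddZeroVertex_bothSigns (hK : IsImaginaryQuadratic K) (hp2 : p ≠ 2) (hc1 : c ≠ 1)
    (hsup : SignedSupplyAt W K p c) (hcheb : LocalChebAt W K p c) (hodd : OddBottomDim W K p c) :
    ∃ n : Finset (AdmQ W K p), Odd n.card ∧ HasBothSigns W K p c n ∧ (∀ μ : Bool, SelQP W K p c n μ = ⊥) ∧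
      n.card = finrank (ZMod p) (SelQP W K p c ∅ true) + finrank (ZMod p) (SelQP W K p c ∅ false) + 4 := by
  obtain ⟨n₀, -, hz₀, hcard₀⟩ := exists_zero_vertex_above_of_localChebAt hK hp2 hc1 hcheb ∅
  rw [Finset.card_empty, zero_add] at hcard₀
  obtain ⟨q₁, q₁', hq₁, hq₁', hs₁, -, hz₁⟩ := exists_signed_detour hK hp2 hc1 hsup hcheb n₀ hz₀ true
  obtain ⟨q₂, q₂', hq₂, hq₂', hs₂, -, hz₂⟩ := exists_signed_detour hK hp2 hc1 hsup hcheb _ hz₁ false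
  have hcard : (insert q₂' (insert q₂ (insert q₁' (insert q₁ n₀)))).card = n₀.card + 4 := by
    rw [Finset.card_insert_of_notMem hq₂', Finset.card_insert_of_notMem hq₂, Finset.card_insert_of_notMem hq₁',
      Finset.card_insert_of_notMem hq₁]
  refine ⟨insert q₂' (insert q₂ (insert q₁' (insert q₁ n₀))), ?_, fun s ↦ ?_, hz₂, by rw [hcard, hcard₀]⟩
  · rw [hcard, hcard₀]
    exact hodd.add_even (by decide)
  · cases s
    · exact ⟨q₂, by simp, hs₂⟩
    · exact ⟨q₁, by simp, hs₁⟩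

end Detour

/-! ## §4 The composition to [NV″]'s consequent VERBATIM (v6.1 `Lines/admdef.lean` ll.474–499 ∕ 506–531) -/

section Assembly

variable {W K p}

omit [NumberField K] [W.IsElliptic] [Fact p.Prime] in
/-- A finite set of admissible primes, read in `ℕ`, is a Zhang admissible level. [cite: WZhang2014, Notations (xiv)] -/
theorem isZhangAdmissibleLevel_image_val (n : Finset (AdmQ W K p)) :
    IsZhangAdmissibleLevel (W.conductorNorm ℤ) K (fun ℓ ↦ W.frobeniusTrace ℓ) p (n.image Subtype.val) := by
  intro q hq
  obtain ⟨q', -, rfl⟩ := Finset.mem_image.mp hq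
  exact q'.2

omit [NumberField K] [W.IsElliptic] [Fact p.Prime] in
/-- Reading a level in `ℕ` does not change its cardinality. [folklore] -/
theorem card_image_val (n : Finset (AdmQ W K p)) : (n.image Subtype.val).card = n.card :=
  Finset.card_image_of_injective _ Subtype.val_injective

/-- **[NV″] on cell β from (Sup±) + (Cheb) + (Par) + (Anch±)** — the consequent of v6.1's `DefiniteToricNVTwoMult` ∕ `DefiniteToricNVLeOneMult` VERBATIM, with
the anchor asked ONLY at odd zero vertices carrying both signs (where [Wan16, Thm. 1.4] applies to `g_n` and to `g_n ⊗ χ_K`).  Conditional on the four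
named Props; nothing is booked.  [cite: CastellaEtAl2025, §7.4] [cite: WZhang2014, Thm. 9.1] [cite: arXiv:1607.07729 (X. Wan 2016), Thm. 1.4] -/
theorem definiteToricNV_of_signdetour {N : ℕ} (hN : (N : ℤ) = W.conductorNorm ℤ)
    (hK : IsImaginaryQuadratic K) (hp2 : p ≠ 2) {c : K ≃ₐ[ℚ] K} (hc1 : c ≠ 1) [Module (ZMod p) (Vp W K p)]
    (hsup : SignedSupplyAt W K p c) (hcheb : LocalChebAt W K p c) (hodd : OddBottomDim W K p c)
    (hanch : DefiniteAnchorAtSigned W K p c N) :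
    ∃ s : Finset ℕ, IsZhangAdmissibleLevel N K (fun ℓ ↦ W.frobeniusTrace ℓ) p s ∧ Odd s.card ∧
      ∃ (S : Brandt.XiSetup N (∏ q ∈ s, q)) (ψ : K →ₐ[ℚ] S.D) (I : Submodule ℤ S.D)
        (φ : Brandt.ClassSet S.O → ZMod p),
        Brandt.IsGrossPoint S.O ψ I ∧
        (letI : Fintype (Brandt.ClassSet S.O) := Fintype.ofFinite _
         φ ∈ Brandt.eigenSpace (ZMod p) (N * ∏ q ∈ s, q) (Brandt.matrix S.O) (fun ℓ ↦ W.frobeniusTrace ℓ)) ∧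
        Brandt.toricPeriod S.O ψ I (fun i ↦ (Brandt.weight S.O i : ZMod p) * φ i) ≠ 0 := by
  have hN' : N = W.conductorNorm ℤ := by exact_mod_cast hN
  obtain ⟨n, hodd', hboth, hzero, -⟩ := exists_oddZeroVertex_bothSigns hK hp2 hc1 hsup hcheb hodd
  obtain ⟨S, ψ, I, φ, hGP, heig, hper⟩ := hanch n hodd' hboth hzero
  refine ⟨n.image Subtype.val, ?_, ?_, S, ψ, I, φ, hGP, heig, hper⟩
  · rw [hN']; exact isZhangAdmissibleLevel_image_val n
  · rw [card_image_val]; exact hodd'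

/-- **[NV″] on cell β, `c`-FREE plug form** (selwalk's plug shape with the re-typed anchor): (Sup±), (Cheb), (Anch±) for every non-trivial automorphism `c` of `K`
(there is exactly one) and the literal «`dim_𝔽p Sel_p(E/K)` odd».  Conclusion: the consequent of v6.1's `DefiniteToricNVTwoMult` ∕ `DefiniteToricNVLeOneMult` VERBATIM.
Conditional on the named Props; nothing is booked.  [cite: CastellaEtAl2025, §7.4] [cite: WZhang2014, Thm. 9.1, Thm. 9.2] [cite: arXiv:1607.07729 (X. Wan 2016), Thm. 1.4] -/
theorem definiteToricNV_of_signdetour_of_oddSelmerDim {N : ℕ} (hN : (N : ℤ) = W.conductorNorm ℤ)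
    (hK : IsImaginaryQuadratic K) (hp2 : p ≠ 2) [Module (ZMod p) (Vp W K p)]
    (hsup : ∀ c : K ≃ₐ[ℚ] K, c ≠ 1 → SignedSupplyAt W K p c) (hcheb : ∀ c : K ≃ₐ[ℚ] K, c ≠ 1 → LocalChebAt W K p c)
    (hodd : OddSelmerDim W K p) (hanch : ∀ c : K ≃ₐ[ℚ] K, c ≠ 1 → DefiniteAnchorAtSigned W K p c N) :
    ∃ s : Finset ℕ, IsZhangAdmissibleLevel N K (fun ℓ ↦ W.frobeniusTrace ℓ) p s ∧ Odd s.card ∧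
      ∃ (S : Brandt.XiSetup N (∏ q ∈ s, q)) (ψ : K →ₐ[ℚ] S.D) (I : Submodule ℤ S.D)
        (φ : Brandt.ClassSet S.O → ZMod p),
        Brandt.IsGrossPoint S.O ψ I ∧
        (letI : Fintype (Brandt.ClassSet S.O) := Fintype.ofFinite _
         φ ∈ Brandt.eigenSpace (ZMod p) (N * ∏ q ∈ s, q) (Brandt.matrix S.O) (fun ℓ ↦ W.frobeniusTrace ℓ)) ∧
        Brandt.toricPeriod S.O ψ I (fun i ↦ (Brandt.weight S.O i : ZMod p) * φ i) ≠ 0 := by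
  obtain ⟨c, hc1, -⟩ := exists_conj_of_isImaginaryQuadratic (K := K) hK
  exact definiteToricNV_of_signdetour hN hK hp2 hc1 (hsup c hc1) (hcheb c hc1) (oddBottomDim_of_oddSelmerDim W K p c hp2 hK hodd)
    (hanch c hc1)

omit [W.IsElliptic] in
/-- **The ∀-form implies the signed form** (so everything selwalk concluded from `DefiniteAnchorAt` it concludes from less): bookkeeping. [folklore] -/
theorem definiteAnchorAtSigned_of_forall {N : ℕ} {c : K ≃ₐ[ℚ] K} [Module (ZMod p) (Vp W K p)]
    (h : ∀ n : Finset (AdmQ W K p), Odd n.card → (∀ μ : Bool, SelQP W K p c n μ = ⊥) →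
      ∃ (S : Brandt.XiSetup N (∏ q ∈ n.image Subtype.val, q)) (ψ : K →ₐ[ℚ] S.D) (I : Submodule ℤ S.D)
        (φ : Brandt.ClassSet S.O → ZMod p),
        Brandt.IsGrossPoint S.O ψ I ∧
        (letI : Fintype (Brandt.ClassSet S.O) := Fintype.ofFinite _
         φ ∈ Brandt.eigenSpace (ZMod p) (N * ∏ q ∈ n.image Subtype.val, q) (Brandt.matrix S.O) (fun ℓ ↦ W.frobeniusTrace ℓ)) ∧
        Brandt.toricPeriod S.O ψ I (fun i ↦ (Brandt.weight S.O i : ZMod p) * φ i) ≠ 0) :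
    DefiniteAnchorAtSigned W K p c N :=
  fun n hodd _ hzero ↦ h n hodd hzero

end Assembly

/-! ## §5 (REV 2) THE v7 PLUG — (Sup±) DISCHARGED DOWN TO «both eigenspaces of `c` on `H¹(K, E[p])` are non-zero», (Cheb) KERNEL on β, and the
## plug into the LEAD's skeleton v7 (`Lines/admdef.lean` 428d042669deeba3, landed 2026-08-29T17:25:55Z) in ITS OWN CURRENCY

What changed between rev 1 and rev 2 (critic idea-crit-15 VERDICT #27u, price P1 «re-key to v7»): the LEAD's v7 consumed «selwalk» — W. Zhang's walk and
(Cheb) on cell β are KERNEL (`Theorems/…AdmdefSelmerWalk.lean` p733010: `localCheb_of_admQ_of_split`; `…AdmdefChebSplit.lean` p732411: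
`exists_admissible_loc_ne_zero_of_target`; `…AdmdefChebSplitTarget.lean` p732181: `exists_admissible_target_of_split`, whose statement EXPORTS the sign
`(hν : ν = 1 ∨ ν = -1)`), v6's [NV″] texts are DERIVED (`definiteNV_twoMult/leOneMult`), and the research residue is `stub_oddSelmerDim : OddSelmerDimBeta`
(l.710, (Par)) + `stub_definiteAnchor : DefiniteAnchorNS` (l.716, (Anch) = (P3), HARDEST).  In that currency «signdetour» is: REPLACE `DefiniteAnchorNS` by
`DefiniteAnchorSignedNS` (its text with ONE inserted binder `HasBothSigns W K p c n →`, §5c) — and this section shows the replacement costs the LEAD NO new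
Čebotarev stub: (Sup±) follows IN KERNEL (§5a `signedSupplyAt_of_eigenSupply`: AKR∕LEAD Čebotarev-with-sign applied to ANY non-zero `s`-eigenclass of
`H¹(K, E[p])`, then the sign of the detecting prime is PINNED by `equivSign_of_loc_ne_zero` = W. Zhang (9.2)) from the residual
(Eig±) `EigenSupplyAt` «for each sign `s` there is a non-zero class `x ∈ H¹(K, E[p])` with `c·x = sgnP s · x`» — HALF of which is free under (Par)
(§5b: the odd bottom Selmer group has a non-zero eigenclass of SOME sign), and all of which is PRINT: `H¹(K, E[p])⁺ ≅ H¹(ℚ, E[p])`,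
`H¹(K, E[p])⁻ ≅ H¹(ℚ, E[p] ⊗ χ_K)` (inflation–restriction, `p` odd) are both non-zero (indeed infinite) by Tate's global Euler–Poincaré characteristic over `ℚ`
(`h¹(G_{ℚ,S}, M) − h⁰ − h² = dim M − dim M^{c_∞} = 2 − 1 = 1` for `M = E[p]`, `E[p] ⊗ χ_K`; Milne ADT I Thm. 5.1 — the tree proves the formula at TOTALLY
COMPLEX fields only, `Literature.NumberTheory.GaloisCohomology.tateGlobalEulerPoincareCharacteristic_of_isTotallyComplex`, which gives `h¹(G_{K,S}, E[p]) ≥ 2`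
but not the eigen-split; port pending, NOT asserted).  §5d: `definiteNV_twoMult_of_signdetour` ∕ `definiteNV_leOneMult_of_signdetour` :
`EigenSupplyNS → OddSelmerDimBeta → DefiniteAnchorSignedNS → DefiniteToricNVTwoMult ∕ LeOneMult` (v7 texts copied VERBATIM by script from the tree file,
spans ll.506–531 ∕ 538–563 ∕ 577–584 ∕ 602–626, attribute `@[conjecture]` dropped, nothing else touched), and `definiteAnchorSignedNS_of_definiteAnchorNS`
(v7's (Anch) ⟹ (Anch±): the re-key asks LESS of the hands).  Nothing here is registered; the LEAD's files are untouched; no stub of v7 is proved.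
[cite: WZhang2014, Lemma 7.3, §9 (9.2)] [cite: BertoliniDarmon2005, Thm. 3.2] [cite: MilneADT2006, Ch. I, Thm. 5.1, Cor. 4.15] -/

section V7Plug

/-! ### §5a (Sup±) ⟸ (Eig±) in kernel -/

section Supply

variable (c : K ≃ₐ[ℚ] K) [Module (ZMod p) (Vp W K p)]

/-- **(Eig±) — both eigenspaces of complex conjugation on `H¹(K, E[p])` are non-zero**: for each sign `s` a non-zero class `x` with `c·x = sgnP s · x`
(NOT Selmer, no local condition).  PRINT (Tate global Euler–Poincaré characteristic over `ℚ` for `E[p]` and `E[p] ⊗ χ_K` + inflation–restriction), port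
pending; the residual hands input of «signdetour» in v7 currency; HALF of it is free under (Par) (`eigenSupplyAt_sign_of_selQP_ne_bot`).
[cite: MilneADT2006, Ch. I, Thm. 5.1, Cor. 4.15] [cite: NeukirchSchmidtWingberg2008, (8.7.4)] -/
def EigenSupplyAt : Prop :=
  ∀ s : Bool, ∃ x : Vp W K p, x ≠ 0 ∧ conjAct W c ((p ^ 1 : ℕ) : ℤ) x = sgnP s • x

variable {W K p c}

omit [Module (ZMod p) (Vp W K p)] in
/-- **SIGN PINNING (W. Zhang (9.2))**: an admissible prime at whose place a NON-ZERO localisation of an `s`-eigenclass lives has (Equiv)-sign `s` (it has some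
sign by AKR `localEquiv_of_admQ`, and the wrong one kills every `s`-eigen localisation on odd torsion, AKR `loc_eq_zero_of_sign_ne_odd`).
[cite: WZhang2014, §9 (9.2)] -/
theorem equivSign_of_loc_ne_zero (hK2 : Module.finrank ℚ K = 2) (hc1 : c ≠ 1) (hp2 : p ≠ 2) {q : AdmQ W K p} {s : Bool} {x : Vp W K p}
    (hx : conjAct W c ((p ^ 1 : ℕ) : ℤ) x = sgnP s • x) {v : HeightOneSpectrum (𝓞 K)} (hqv : ((q : ℕ) : 𝓞 K) ∈ v.asIdeal)
    (hloc : (W.baseChange K).torsionLocMap (v.adicCompletion K) ((p ^ 1 : ℕ) : ℤ) x ≠ 0) : EquivSign W K p c q s := by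
  have hp : p.Prime := Fact.out
  have hNodd : Odd (((p ^ 1 : ℕ) : ℤ)) := by
    rw [pow_one]; exact_mod_cast hp.odd_of_ne_two hp2
  obtain ⟨s', hs'⟩ := equivSign_exists W K p c hK2 hc1 q
  by_cases h : s' = s
  · exact h ▸ hs'
  · exact absurd
      (loc_eq_zero_of_sign_ne_odd (conjAct W c ((p ^ 1 : ℕ) : ℤ)) ((W.baseChange K).torsionLocMap (v.adicCompletion K) ((p ^ 1 : ℕ) : ℤ))
        (hs' v hqv) hx h hNodd (zsmul_discreteH1_torsion ((p ^ 1 : ℕ) : ℤ) _)) hloc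

omit [Module (ZMod p) (Vp W K p)] in
/-- **(Sup±) FROM (Eig±), KERNEL on cell β** (`p ≥ 5`, `ρ̄_{E,p}` onto, `K` imaginary quadratic, `N_E` Heegner in `K`, `p` SPLIT in `K`, `c ≠ 1`): for each
sign `s` and finite `B₀`, an admissible `q ∉ B₀` of (Equiv)-sign `s` — the LEAD's Čebotarev-with-sign on β (`…AdmdefChebSplit.exists_admissible_loc_ne_zero_of_target`
fed with `…exists_admissible_target_of_split`, `ν = sgnP s`) applied to the non-zero `s`-eigenclass of (Eig±) (ANY class: the theorem has no Selmer
hypothesis), then `equivSign_of_loc_ne_zero`.  So the signed re-key costs the LEAD no Čebotarev stub beyond (Eig±).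
[cite: WZhang2014, Lemma 7.3, §9 (9.2)] [cite: BertoliniDarmon2005, Thm. 3.2] -/
theorem signedSupplyAt_of_eigenSupply (h5 : 5 ≤ p) (hsurj : W.HasSurjectiveModNGaloisRep p) (hK : IsImaginaryQuadratic K)
    (hH : SatisfiesHeegnerHypothesis (W.conductorNorm ℤ) K) (hsp : ((Ideal.span {(p : ℤ)}).primesOver (𝓞 K)).ncard = 2)
    (hc1 : c ≠ 1) (heig : EigenSupplyAt W K p c) : SignedSupplyAt W K p c := by
  intro s B₀
  obtain ⟨x, hx0, hx⟩ := heig s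
  -- as in `…AdmdefSelmerWalk.localCheb_of_admQ_of_split` (l.67–93), minus the Selmer hypothesis
  have hp : p.Prime := Fact.out
  haveI : Fact (Nat.Prime (p ^ 1)) := ⟨by rw [pow_one]; exact hp⟩
  have h5' : 5 ≤ p ^ 1 := by rw [pow_one]; exact h5
  have hsp' : ((Ideal.span {((p ^ 1 : ℕ) : ℤ)}).primesOver (𝓞 K)).ncard = 2 := by rw [pow_one]; exact hsp
  have hsurj' : W.HasSurjectiveModNGaloisRep ((p ^ 1 : ℕ) : ℤ) := by rw [Nat.pow_one]; exact hsurj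
  have hν : sgnP s = 1 ∨ sgnP s = -1 := by cases s <;> simp [sgnP]
  obtain ⟨q, hqB, hadm, v, hqv, hloc⟩ :=
    SignedBaseChangeAcDivAdmdefChebSplit.exists_admissible_loc_ne_zero_of_target W K (p := p ^ 1) h5' hK hsurj' hc1 hν
      (fun ht hinv ↦ SignedBaseChangeAcDivAdmdefChebSplit.exists_admissible_target_of_split W K (p := p ^ 1) h5' hK hsurj' hsp'
        hH ht hinv hν)
      hx0 hx (B₀.image Subtype.val)
  rw [Nat.pow_one] at hadm
  refine ⟨⟨q, hadm⟩, fun hqn ↦ hqB (Finset.mem_image.mpr ⟨⟨q, hadm⟩, hqn, rfl⟩), ?_⟩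
  exact equivSign_of_loc_ne_zero hK.1 hc1 (by omega) hx hqv (fun h0 ↦ hloc h0)

/-! ### §5b HALF of (Eig±) is free: a non-zero eigen-Selmer space gives an eigenclass of its sign; under (Par) one sign is present -/

set_option linter.unusedSectionVars false in
omit [W.IsElliptic] in
/-- A non-zero `Sel_n^μ` contains a non-zero `μ`-eigenclass (AKR `conjAct_eq_of_mem_selQP`). [cite: WZhang2014, §5] -/
theorem exists_eigenclass_of_selQP_ne_bot {n : Finset (AdmQ W K p)} {μ : Bool} (h : SelQP W K p c n μ ≠ ⊥) :
    ∃ x : Vp W K p, x ≠ 0 ∧ conjAct W c ((p ^ 1 : ℕ) : ℤ) x = sgnP μ • x := by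
  obtain ⟨x, hx, hx0⟩ := (Submodule.ne_bot_iff _).mp h
  exact ⟨x, hx0, conjAct_eq_of_mem_selQP W K p c n μ hx⟩

omit [W.IsElliptic] in
/-- **Under (Par) ONE sign is free**: an odd `dim Sel_∅⁺ + dim Sel_∅⁻` forces some `Sel_∅^μ ≠ 0`, hence a non-zero `μ`-eigenclass — so (Eig±) is needed
only for the other sign (and only when `Sel_∅` of that sign vanishes). [cite: WZhang2014, Thm. 9.1 (proof)] -/
theorem exists_sign_eigenclass_of_oddBottomDim (hodd : OddBottomDim W K p c) :
    ∃ (μ : Bool) (x : Vp W K p), x ≠ 0 ∧ conjAct W c ((p ^ 1 : ℕ) : ℤ) x = sgnP μ • x := by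
  by_cases h : SelQP W K p c ∅ true = ⊥
  · by_cases h' : SelQP W K p c ∅ false = ⊥
    · exfalso
      have h0 : finrank (ZMod p) (SelQP W K p c ∅ true) + finrank (ZMod p) (SelQP W K p c ∅ false) = 0 := by
        rw [h, h', finrank_bot]
      rw [OddBottomDim, h0] at hodd
      exact (Nat.not_odd_iff_even.mpr (by decide)) hodd
    · exact ⟨false, exists_eigenclass_of_selQP_ne_bot h'⟩
  · exact ⟨true, exists_eigenclass_of_selQP_ne_bot h⟩

/-! ### §5c (Cheb) on β is KERNEL (LEAD v7): the adapter to this file's `LocalChebAt` -/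

/-- **(Cheb) on cell β, KERNEL** — `LocalChebAt` is the statement of `…AdmdefSelmerWalk.localCheb_of_admQ_of_split` (p733010) verbatim.
[cite: WZhang2014, Lemma 7.3] [cite: BertoliniDarmon2005, Thm. 3.2] -/
theorem localChebAt_of_split (h5 : 5 ≤ p) (hsurj : W.HasSurjectiveModNGaloisRep p) (hK : IsImaginaryQuadratic K)
    (hH : SatisfiesHeegnerHypothesis (W.conductorNorm ℤ) K) (hsp : ((Ideal.span {(p : ℤ)}).primesOver (𝓞 K)).ncard = 2)
    (hc1 : c ≠ 1) : LocalChebAt W K p c :=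
  SignedBaseChangeAcDivAdmdefSelmerWalk.localCheb_of_admQ_of_split W K p h5 hsurj hK hH hsp hc1

end Supply

/-! ### §5d The v7 stub texts, COPIED VERBATIM by script from `Cruxes/AnticyclotomicEisensteinDivisibility/Lines/admdef.lean` (428d042669deeba3;
Cruxes files are not importable) — attribute `@[conjecture]` dropped, bodies byte-identical — and the SIGNED re-key of (Anch) -/

/-- v7 `DefiniteToricNVTwoMult` (ll.506–531), VERBATIM copy ([NV″] on β′). [cite: CastellaEtAl2025, §7.4] [cite: WZhang2014, Thm. 9.1] -/
def DefiniteToricNVTwoMult : Prop :=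
  ∀ {p : ℕ} [Fact p.Prime] (W : WeierstrassCurve ℚ) [W.IsElliptic] [W.IsGloballyMinimal]
    (K : Type) [Field K] [NumberField K] {N : ℕ} [NeZero N] {f : CuspForm (CongruenceSubgroup.Gamma0 N) 2}
    (_ : IsNewformOf W f),
    (N : ℤ) = W.conductorNorm ℤ → 5 ≤ p → W.HasGoodReductionAtPrime p → W.frobeniusTrace p = 0 →
    Surj W p →
    IsImaginaryQuadratic K → ((Ideal.span {(p : ℤ)}).primesOver (𝓞 K)).ncard = 2 →
    (∀ ℓ : ℕ, ℓ.Prime → ℓ ∣ N → ((Ideal.span {(ℓ : ℤ)}).primesOver (𝓞 K)).ncard = 2) →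
    IsCoprime (N : ℤ) (NumberField.discr K) → ¬ p ∣ NumberField.classNumber K →
    -- (i) NEGATED: `N` is NOT square-free
    ¬ Squarefree N →
    -- β′: at least TWO primes divide `N` exactly once
    (∃ ℓ₁ ℓ₂ : ℕ, ℓ₁.Prime ∧ ℓ₂.Prime ∧ ℓ₁ ≠ ℓ₂ ∧ ℓ₁ ∣ N ∧ ¬ ℓ₁ ^ 2 ∣ N ∧ ℓ₂ ∣ N ∧ ¬ ℓ₂ ^ 2 ∣ N) →
    -- (ii): `E[p]` ramified at every prime `q ∣ N`
    (∀ q : ℕ, q.Prime → q ∣ N →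
      ∃ v : HeightOneSpectrum (𝓞 ℚ), ((q : ℕ) : 𝓞 ℚ) ∈ v.asIdeal ∧
        ∃ 𝔓 ∈ v.primesAbove, ∃ σ ∈ 𝔓.inertia (absoluteGaloisGroup ℚ),
          ∃ P : W.geomTorsion (p : ℤ), σ • P ≠ P) →
    -- [NV″]: a definite vertex with a non-zero mod-p toric period
    ∃ s : Finset ℕ, IsZhangAdmissibleLevel N K (fun ℓ ↦ W.frobeniusTrace ℓ) p s ∧ Odd s.card ∧
      ∃ (S : Brandt.XiSetup N (∏ q ∈ s, q)) (ψ : K →ₐ[ℚ] S.D) (I : Submodule ℤ S.D)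
        (φ : Brandt.ClassSet S.O → ZMod p),
        Brandt.IsGrossPoint S.O ψ I ∧
        (letI : Fintype (Brandt.ClassSet S.O) := Fintype.ofFinite _
         φ ∈ Brandt.eigenSpace (ZMod p) (N * ∏ q ∈ s, q) (Brandt.matrix S.O) (fun ℓ ↦ W.frobeniusTrace ℓ)) ∧
        Brandt.toricPeriod S.O ψ I (fun i ↦ (Brandt.weight S.O i : ZMod p) * φ i) ≠ 0

/-- v7 `DefiniteToricNVLeOneMult` (ll.538–563), VERBATIM copy ([NV″] on β″). [cite: CastellaEtAl2025, §7.4] [cite: KimOta2023, Thm. 1.3, Cor. 5.7 (arXiv:1905.02926)] -/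
def DefiniteToricNVLeOneMult : Prop :=
  ∀ {p : ℕ} [Fact p.Prime] (W : WeierstrassCurve ℚ) [W.IsElliptic] [W.IsGloballyMinimal]
    (K : Type) [Field K] [NumberField K] {N : ℕ} [NeZero N] {f : CuspForm (CongruenceSubgroup.Gamma0 N) 2}
    (_ : IsNewformOf W f),
    (N : ℤ) = W.conductorNorm ℤ → 5 ≤ p → W.HasGoodReductionAtPrime p → W.frobeniusTrace p = 0 →
    Surj W p →
    IsImaginaryQuadratic K → ((Ideal.span {(p : ℤ)}).primesOver (𝓞 K)).ncard = 2 →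
    (∀ ℓ : ℕ, ℓ.Prime → ℓ ∣ N → ((Ideal.span {(ℓ : ℤ)}).primesOver (𝓞 K)).ncard = 2) →
    IsCoprime (N : ℤ) (NumberField.discr K) → ¬ p ∣ NumberField.classNumber K →
    -- (i) NEGATED: `N` is NOT square-free
    ¬ Squarefree N →
    -- β″: at most ONE prime divides `N` exactly once (includes squarefull `N`)
    ¬ (∃ ℓ₁ ℓ₂ : ℕ, ℓ₁.Prime ∧ ℓ₂.Prime ∧ ℓ₁ ≠ ℓ₂ ∧ ℓ₁ ∣ N ∧ ¬ ℓ₁ ^ 2 ∣ N ∧ ℓ₂ ∣ N ∧ ¬ ℓ₂ ^ 2 ∣ N) →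
    -- (ii): `E[p]` ramified at every prime `q ∣ N`
    (∀ q : ℕ, q.Prime → q ∣ N →
      ∃ v : HeightOneSpectrum (𝓞 ℚ), ((q : ℕ) : 𝓞 ℚ) ∈ v.asIdeal ∧
        ∃ 𝔓 ∈ v.primesAbove, ∃ σ ∈ 𝔓.inertia (absoluteGaloisGroup ℚ),
          ∃ P : W.geomTorsion (p : ℤ), σ • P ≠ P) →
    -- [NV″]: a definite vertex with a non-zero mod-p toric period
    ∃ s : Finset ℕ, IsZhangAdmissibleLevel N K (fun ℓ ↦ W.frobeniusTrace ℓ) p s ∧ Odd s.card ∧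
      ∃ (S : Brandt.XiSetup N (∏ q ∈ s, q)) (ψ : K →ₐ[ℚ] S.D) (I : Submodule ℤ S.D)
        (φ : Brandt.ClassSet S.O → ZMod p),
        Brandt.IsGrossPoint S.O ψ I ∧
        (letI : Fintype (Brandt.ClassSet S.O) := Fintype.ofFinite _
         φ ∈ Brandt.eigenSpace (ZMod p) (N * ∏ q ∈ s, q) (Brandt.matrix S.O) (fun ℓ ↦ W.frobeniusTrace ℓ)) ∧
        Brandt.toricPeriod S.O ψ I (fun i ↦ (Brandt.weight S.O i : ZMod p) * φ i) ≠ 0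

/-- v7 `OddSelmerDimBeta` (ll.577–584), VERBATIM copy ((Par), stub `stub_oddSelmerDim` l.710). [cite: DokchitserDokchitserAnnals2010, §4.6, Thm. 4.19] [cite: WZhang2014, Thm. 9.2] -/
def OddSelmerDimBeta : Prop :=
  ∀ {p : ℕ} [Fact p.Prime] (W : WeierstrassCurve ℚ) [W.IsElliptic] [W.IsGloballyMinimal]
    (K : Type) [Field K] [NumberField K] {N : ℕ},
    (N : ℤ) = W.conductorNorm ℤ → 5 ≤ p → Surj W p → IsImaginaryQuadratic K →
    (∀ ℓ : ℕ, ℓ.Prime → ℓ ∣ N → ((Ideal.span {(ℓ : ℤ)}).primesOver (𝓞 K)).ncard = 2) →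
    ∀ (c : K ≃ₐ[ℚ] K), c ≠ 1 → ∀ [Module (ZMod p) (AdditiveKoly.Vp W K p)],
      Odd (Module.finrank (ZMod p) (AdditiveKoly.SelQP W K p c ∅ true) +
        Module.finrank (ZMod p) (AdditiveKoly.SelQP W K p c ∅ false))

/-- v7 `DefiniteAnchorNS` (ll.602–626), VERBATIM copy ((Anch) = (P3), stub `stub_definiteAnchor` l.716, HARDEST). [cite: WZhang2014, Thm. 5.2, Thm. 7.2] [cite: CastellaEtAl2025, §7.4, Thm. 7.6] -/
def DefiniteAnchorNS : Prop :=
  ∀ {p : ℕ} [Fact p.Prime] (W : WeierstrassCurve ℚ) [W.IsElliptic] [W.IsGloballyMinimal]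
    (K : Type) [Field K] [NumberField K] {N : ℕ} [NeZero N] {f : CuspForm (CongruenceSubgroup.Gamma0 N) 2}
    (_ : IsNewformOf W f),
    (N : ℤ) = W.conductorNorm ℤ → 5 ≤ p → W.HasGoodReductionAtPrime p → W.frobeniusTrace p = 0 →
    Surj W p →
    IsImaginaryQuadratic K → ((Ideal.span {(p : ℤ)}).primesOver (𝓞 K)).ncard = 2 →
    (∀ ℓ : ℕ, ℓ.Prime → ℓ ∣ N → ((Ideal.span {(ℓ : ℤ)}).primesOver (𝓞 K)).ncard = 2) →
    IsCoprime (N : ℤ) (NumberField.discr K) → ¬ p ∣ NumberField.classNumber K →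
    -- (i) NEGATED: `N` is NOT square-free
    ¬ Squarefree N →
    -- (ii): `E[p]` ramified at every prime `q ∣ N`
    (∀ q : ℕ, q.Prime → q ∣ N →
      ∃ v : HeightOneSpectrum (𝓞 ℚ), ((q : ℕ) : 𝓞 ℚ) ∈ v.asIdeal ∧
        ∃ 𝔓 ∈ v.primesAbove, ∃ σ ∈ 𝔓.inertia (absoluteGaloisGroup ℚ),
          ∃ P : W.geomTorsion (p : ℤ), σ • P ≠ P) →
    -- (Anch): at every ODD ZERO VERTEX of the level-raised Selmer walk, Brandt data with a non-zero mod-p toric period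
    ∀ (c : K ≃ₐ[ℚ] K), c ≠ 1 → ∀ [Module (ZMod p) (AdditiveKoly.Vp W K p)],
      ∀ n : Finset (AdditiveKoly.AdmQ W K p), Odd n.card → (∀ μ : Bool, AdditiveKoly.SelQP W K p c n μ = ⊥) →
        ∃ (S : Brandt.XiSetup N (∏ q ∈ n.image Subtype.val, q)) (ψ : K →ₐ[ℚ] S.D) (I : Submodule ℤ S.D)
          (φ : Brandt.ClassSet S.O → ZMod p),
          Brandt.IsGrossPoint S.O ψ I ∧
          (letI : Fintype (Brandt.ClassSet S.O) := Fintype.ofFinite _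
           φ ∈ Brandt.eigenSpace (ZMod p) (N * ∏ q ∈ n.image Subtype.val, q) (Brandt.matrix S.O) (fun ℓ ↦ W.frobeniusTrace ℓ)) ∧
          Brandt.toricPeriod S.O ψ I (fun i ↦ (Brandt.weight S.O i : ZMod p) * φ i) ≠ 0

/-- **(Anch±) — THE SIGNED RE-KEY of v7's `DefiniteAnchorNS`**: its text with ONE inserted binder `HasBothSigns W K p c n →` (the anchor is asked only at odd
zero vertices carrying an admissible prime of EACH (Equiv)-sign — where [Wan16, Thm. 1.4]'s Steinberg-sign hypothesis holds for `g_n` AND for `g_n ⊗ χ_K`).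
The candidate replacement text for `stub_definiteAnchor` (LEAD's decision).  [cite: arXiv:1607.07729 (X. Wan 2016), Thm. 1.4, Rem. 1.5, p.18 L2, p.22 L30]
[cite: WZhang2014, Thm. 5.2, Thm. 7.2] [cite: SkinnerZhang2014, Cor. 9.2] -/
def DefiniteAnchorSignedNS : Prop :=
  ∀ {p : ℕ} [Fact p.Prime] (W : WeierstrassCurve ℚ) [W.IsElliptic] [W.IsGloballyMinimal]
    (K : Type) [Field K] [NumberField K] {N : ℕ} [NeZero N] {f : CuspForm (CongruenceSubgroup.Gamma0 N) 2}
    (_ : IsNewformOf W f),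
    (N : ℤ) = W.conductorNorm ℤ → 5 ≤ p → W.HasGoodReductionAtPrime p → W.frobeniusTrace p = 0 →
    Surj W p →
    IsImaginaryQuadratic K → ((Ideal.span {(p : ℤ)}).primesOver (𝓞 K)).ncard = 2 →
    (∀ ℓ : ℕ, ℓ.Prime → ℓ ∣ N → ((Ideal.span {(ℓ : ℤ)}).primesOver (𝓞 K)).ncard = 2) →
    IsCoprime (N : ℤ) (NumberField.discr K) → ¬ p ∣ NumberField.classNumber K →
    -- (i) NEGATED: `N` is NOT square-free
    ¬ Squarefree N →
    -- (ii): `E[p]` ramified at every prime `q ∣ N`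
    (∀ q : ℕ, q.Prime → q ∣ N →
      ∃ v : HeightOneSpectrum (𝓞 ℚ), ((q : ℕ) : 𝓞 ℚ) ∈ v.asIdeal ∧
        ∃ 𝔓 ∈ v.primesAbove, ∃ σ ∈ 𝔓.inertia (absoluteGaloisGroup ℚ),
          ∃ P : W.geomTorsion (p : ℤ), σ • P ≠ P) →
    -- (Anch): at every ODD ZERO VERTEX of the level-raised Selmer walk, Brandt data with a non-zero mod-p toric period
    ∀ (c : K ≃ₐ[ℚ] K), c ≠ 1 → ∀ [Module (ZMod p) (AdditiveKoly.Vp W K p)],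
      ∀ n : Finset (AdditiveKoly.AdmQ W K p), Odd n.card → HasBothSigns W K p c n → (∀ μ : Bool, AdditiveKoly.SelQP W K p c n μ = ⊥) →
        ∃ (S : Brandt.XiSetup N (∏ q ∈ n.image Subtype.val, q)) (ψ : K →ₐ[ℚ] S.D) (I : Submodule ℤ S.D)
          (φ : Brandt.ClassSet S.O → ZMod p),
          Brandt.IsGrossPoint S.O ψ I ∧
          (letI : Fintype (Brandt.ClassSet S.O) := Fintype.ofFinite _
           φ ∈ Brandt.eigenSpace (ZMod p) (N * ∏ q ∈ n.image Subtype.val, q) (Brandt.matrix S.O) (fun ℓ ↦ W.frobeniusTrace ℓ)) ∧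
          Brandt.toricPeriod S.O ψ I (fun i ↦ (Brandt.weight S.O i : ZMod p) * φ i) ≠ 0

/-- **(Eig±) on the frame** — the residual HANDS input of «signdetour» in v7 currency (PRINT: Tate's global Euler–Poincaré characteristic over `ℚ`, port pending;
half of it free under (Par), §5b).  [cite: MilneADT2006, Ch. I, Thm. 5.1, Cor. 4.15] -/
def EigenSupplyNS : Prop :=
  ∀ {p : ℕ} [Fact p.Prime] (W : WeierstrassCurve ℚ) [W.IsElliptic] [W.IsGloballyMinimal]
    (K : Type) [Field K] [NumberField K],
    5 ≤ p → Surj W p → IsImaginaryQuadratic K →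
    ∀ (c : K ≃ₐ[ℚ] K), c ≠ 1 → ∀ [Module (ZMod p) (AdditiveKoly.Vp W K p)], EigenSupplyAt W K p c

/-! ### §5e The plug theorems in v7 currency -/

/-- `H¹(K, E[p])` is killed by `p` (copy of v7's `p_nsmul_vp_eq_zero`; feeds `AddCommGroup.zmodModule`). [folklore] -/
theorem p_nsmul_vp_eq_zero' {p : ℕ} [Fact p.Prime] (W : WeierstrassCurve ℚ) (K : Type) [Field K] [NumberField K]
    (x : AdditiveKoly.Vp W K p) : p • x = 0 := by
  have h := Literature.NumberTheory.EllipticCurves.zsmul_galH1Torsion_eq_zero (W.baseChange K) ((p ^ 1 : ℕ) : ℤ) x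
  rw [← natCast_zsmul]
  convert h using 2
  push_cast
  ring

/-- **v7's (Anch) implies (Anch±)** — the re-key asks STRICTLY LESS of the hands (bookkeeping). [folklore] -/
theorem definiteAnchorSignedNS_of_definiteAnchorNS (h : DefiniteAnchorNS) : DefiniteAnchorSignedNS := by
  intro p _ W _ _ K _ _ N _ f hf hN hp hgood hap hsurj hK hsplit hHeeg hcop hh hnsq hram c hc1 _ n hodd _ hzero
  exact h W K hf hN hp hgood hap hsurj hK hsplit hHeeg hcop hh hnsq hram c hc1 n hodd hzero

/-- **[NV″] on β′ (v7 text `DefiniteToricNVTwoMult`) FROM (Eig±) + (Par) + (Anch±)** — W. Zhang's walk + the signed detour in kernel, (Cheb) and (Sup±)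
discharged on cell β's frame (`p` split supplies the Heegner∕disjointness data; the β′ line is not used).  Conditional on the three displayed Props; nothing booked.
[cite: CastellaEtAl2025, §7.4] [cite: WZhang2014, Thm. 9.1, Lemma 7.3, §9 (9.2)] [cite: arXiv:1607.07729 (X. Wan 2016), Thm. 1.4] -/
theorem definiteNV_twoMult_of_signdetour (heig : EigenSupplyNS) (hpar : OddSelmerDimBeta) (hanch : DefiniteAnchorSignedNS) :
    DefiniteToricNVTwoMult := by
  intro p _ W _ _ K _ _ N _ f hf hN hp hgood hap hsurj hK hsplit hHeeg hcop hh hnsq _h2m hram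
  obtain ⟨c, hc1, -⟩ := exists_conj_of_isImaginaryQuadratic (K := K) hK
  letI : Module (ZMod p) (AdditiveKoly.Vp W K p) := AddCommGroup.zmodModule (p_nsmul_vp_eq_zero' W K)
  have hN' : N = W.conductorNorm ℤ := by exact_mod_cast hN
  have hH : SatisfiesHeegnerHypothesis (W.conductorNorm ℤ) K := fun ℓ hℓ hℓN ↦ hHeeg ℓ hℓ (hN' ▸ hℓN)
  exact definiteToricNV_of_signdetour hN hK (by omega) hc1
    (signedSupplyAt_of_eigenSupply hp hsurj hK hH hsplit hc1 (heig W K hp hsurj hK c hc1))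
    (localChebAt_of_split hp hsurj hK hH hsplit hc1)
    (hpar W K hN hp hsurj hK hHeeg c hc1)
    (hanch W K hf hN hp hgood hap hsurj hK hsplit hHeeg hcop hh hnsq hram c hc1)

/-- **[NV″] on β″ (v7 text `DefiniteToricNVLeOneMult`) FROM (Eig±) + (Par) + (Anch±)**, the same way (the β″ line is not used).
[cite: CastellaEtAl2025, §7.4] [cite: WZhang2014, Thm. 9.1] [cite: arXiv:1607.07729 (X. Wan 2016), Thm. 1.4] -/
theorem definiteNV_leOneMult_of_signdetour (heig : EigenSupplyNS) (hpar : OddSelmerDimBeta) (hanch : DefiniteAnchorSignedNS) :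
    DefiniteToricNVLeOneMult := by
  intro p _ W _ _ K _ _ N _ f hf hN hp hgood hap hsurj hK hsplit hHeeg hcop hh hnsq _h2m hram
  obtain ⟨c, hc1, -⟩ := exists_conj_of_isImaginaryQuadratic (K := K) hK
  letI : Module (ZMod p) (AdditiveKoly.Vp W K p) := AddCommGroup.zmodModule (p_nsmul_vp_eq_zero' W K)
  have hN' : N = W.conductorNorm ℤ := by exact_mod_cast hN
  have hH : SatisfiesHeegnerHypothesis (W.conductorNorm ℤ) K := fun ℓ hℓ hℓN ↦ hHeeg ℓ hℓ (hN' ▸ hℓN)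
  exact definiteToricNV_of_signdetour hN hK (by omega) hc1
    (signedSupplyAt_of_eigenSupply hp hsurj hK hH hsplit hc1 (heig W K hp hsurj hK c hc1))
    (localChebAt_of_split hp hsurj hK hH hsplit hc1)
    (hpar W K hN hp hsurj hK hHeeg c hc1)
    (hanch W K hf hN hp hgood hap hsurj hK hsplit hHeeg hcop hh hnsq hram c hc1)

end V7Plug

end Summit.BirchSwinnertonDyer.BirchSwinnertonDyer.Cruxes.AnticyclotomicEisensteinDivisibility.Signdetour

end
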